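/-
Copyright (c) 2026 the pub-hodgecm-mathlib formalisation cell (harness21).  Prover seat hodgecm-mathlib-K2E3-p21 (g5), Track B «K2-LIT» ∕ h413
(`stmt-HodgeConjecture-24833`), line `K2_E3_EllipticInputs`, unit U12 §L, road «EXP» of the leaf (nsc-S-A′) `sig_K2E3GL3PrincipalBlockStandardSpan` (leaf owner
K2E3-p25 (g0), architecture MEMO-SA v1 §2; dealer K2E3-plan (g4) (R-1) 2026-09-04 08:53Z), BRICK G2 (= brick 1 of line «BZ-DERIV≤3»): «a REDUCIBLE principal series
`x × y` of `GL₂(F)` has a one-dimensional constituent `η ∘ det`» — Jacquet–Langlands 1970, Thm. 3.3 (reducible half), via Props. 2.7–2.8 instead of the Kirillov space.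
2026-09-04.
-/
import Literature.NumberTheory.Automorphic.CongruenceSubgroupExpansionGL           -- ★ `nonarchimedeanGroup_gl`
import Literature.NumberTheory.Automorphic.GL2KirillovInjective                    -- ★ JL Props. 2.7 (b) ∕ 2.8 (ii): `mem_of_isOpen_of_unipotentGL2_mem`, `forall_unipotentGL2_apply_eq_of_forall_mem_ker`
import Literature.NumberTheory.Automorphic.WhittakerHeredityGL                      -- ★ Rodier–BZ heredity injection `exists_injective_whittakerFunctionals_smoothIndRep`
import Literature.NumberTheory.Automorphic.CharacterLineFinConstituents             -- ★ constituents of a `χ`-line; brings ★ `IrrClass.IsConstituentOf`, ★ `SmoothIrrep.ofChar`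
import Literature.NumberTheory.Automorphic.AdmissibleSubquotient                    -- ★ `IsAdmissible.toRepresentation` ∕ `.quotientRep`
import Literature.NumberTheory.Automorphic.SmoothInductionParabolicNontrivial       -- ★ `nontrivial_parabolicIndGL_detChar`, `monotone_lastBlockLabel`
import Summits.HodgeConjecture.HodgeConjecture.Theorems.F0P3bSplitMemberAdmissible  -- ★ `parabolicIndGL_leviChar_isAdmissible` (B-p08): `x × y` is admissible
import Summits.HodgeConjecture.HodgeConjecture.Theorems.K2E3JacquetExponentEigenvector  -- ★ E1b (K2E3-p25 g0): `exists_common_eigenvector`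
import HarnessLib

/-!
# K2_E3 (nsc-S-A′), brick G2: a reducible `x × y` on `GL₂(F)` has a one-dimensional constituent `η ∘ det` (Jacquet–Langlands 1970, Thm. 3.3)

Cell `pub/hodgecm-mathlib` (D-0151), Track B, seat K2E3-p21 (g5).  CONSUMER: the H-bricks of K2E3-p25 (g0)'s road «EXP» (JH tables of the principal series of
`GL₃(F)` through the `GL₂` slot `I₂ x y := parabolicIndGL F (lastBlockLabel 2) (𝟙.twist (maxParabolicLeviChar F 2 x y))`).  `--supports stmt-HodgeConjecture-24833
--as helper`; THEOREMS ONLY (no `def`, no instance, no notation, no `sorry`, no new Literature fact).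

THE ARGUMENT (Jacquet–Langlands 1970 Prop. 2.7 (b), Prop. 2.8 (ii) and Lemma 3.2.2∕Thm. 3.3 pp. 94–101, re-routed through the tree's ★ inputs; Bushnell–Henniart
2006 §9.6–9.11 is the same argument through the mirabolic): let `I = x × y` and `0 ⊊ V ⊊ I` a subrepresentation, `W = I ⁄ V`.
* §1 (any `GL_n`) **`whittakerFunctionals_eq_bot_or`**: if `rank Hom_{U}(π, ψ_U) ≤ 1` then for every subrepresentation `N` of a smooth `π`, `Hom_U(N, ψ_U) = 0` or
  `Hom_U(π⁄N, ψ_U) = 0` (a Whittaker functional of `π⁄N` pulls back to a generator of `Hom_U(π,ψ_U)` vanishing on `N`, and every Whittaker functional of `N` EXTENDS to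
  `π` by the exactness of `J_ψ` ★ `twistedJacquetMap_injective`).
* §2 (`GL₂`) **`forall_unipotentGL2_apply_eq_of_whittakerFunctionals_eq_bot`**: `Hom_U(π,ψ) = 0 ⇒ Hom_U(π,ψ_a) = 0` for all `a ∈ F^×` (torus conjugation ★
  `comp_diagGL2_mem_whittakerFunctionals`) `⇒ π(N,ψ_a) = π` `⇒` (★ JL Prop. 2.8 (ii)) `N` acts trivially; **`apply_eq_apply_diagGL2_det`**: then `π(g)v = π(d(det g,1))v`
  (★ JL Prop. 2.7 (b): an open subgroup containing `N` contains `SL₂(F)`).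
* §3 **`exists_line_detChar`**: an ADMISSIBLE non-zero `N`-trivial `π` contains a line `ℂv` with `π(g)v = η(det g)v` (`V^{K}` is finite-dimensional, non-zero and
  TORUS-STABLE since everything commutes with the torus through `det`; ★ common eigenvector); **`exists_isConstituentOf_ofChar_det`**: hence `⟦η∘det⟧` is a constituent
  (★ `isConstituentOf_iff_eq_mk_ofChar_of_forall_apply_eq_smul`).
* §4 **`rank_whittakerFunctionals_parabolicIndGL_char_le_one`** (Rodier heredity into `Dual ℂ ℂ`) and the payload
  **`exists_isConstituentOf_ofChar_det_of_not_isIrreducible`**: `x × y` reducible ⇒ `∃ η, ⟦η ∘ det⟧` is a constituent of `x × y`.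
The additive character `ψ` (continuous, non-trivial) is a PARAMETER, as in every Whittaker-model file of the tree (no ★ existence theorem for an abstract `F`; at the
leaf's consumers `F = K_w` it is ★ `IsGlobalAddChar.isContinuousNontrivial_adicComponent_of_place`).
[JacquetLanglands1970, Props. 2.7–2.8 pp. 20–25, Thm. 3.3 p. 101]; [BushnellHenniart2006, §8.1–8.3, §9.6, §9.11]; [BernsteinZelevinskyASENS1977, Thm. 5.2, §4.7].

HONEST LABEL: HC_CM is proved only modulo the 7 printed citations (2 remaining named inputs: hLiu418 = `stmt-HodgeConjecture-24832`, h413 = `stmt-HodgeConjecture-24833`)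
until rung 0 closes; this file is a count-neutral helper and closes no socket.

## References
* [JacquetLanglands1970] H. Jacquet, R. P. Langlands, *Automorphic Forms on GL(2)*, LNM 114 (1970), §2 Props. 2.7, 2.8; §3 Lemma 3.2.2, Thm. 3.3.
* [BushnellHenniart2006] C. J. Bushnell, G. Henniart, *The Local Langlands Conjecture for GL(2)*, Grundlehren 335 (2006), §8.1–8.3, §9.6–9.11.
* [BernsteinZelevinskyASENS1977] I. N. Bernstein, A. V. Zelevinsky, *Induced representations of reductive p-adic groups I*, Ann. Sci. ÉNS 10 (1977), Thm. 5.2, §4.7.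
-/

set_option autoImplicit false
-- the mandated namespace repeats the single-problem summit's segment (`HodgeConjecture.HodgeConjecture`)
set_option linter.dupNamespace false

noncomputable section

open Literature.NumberTheory.Automorphic Literature.NumberTheory.Automorphic.Zelevinsky1980
open Literature.RepresentationTheory.FiniteGroups Literature.RepresentationTheory.Semisimple
open Summit.HodgeConjecture.HodgeConjecture.Cruxes.H413.K2E3JacquetExponentEigenvector (exists_common_eigenvector)

namespace Summit.HodgeConjecture.HodgeConjecture.Cruxes.H413.K2E3GL2ReducibleInducedDetCharConstituent

/-! ## §1  One Whittaker functional for the whole of `π` ⇒ a subrepresentation or its quotient is degenerate (any `GL_n`) -/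

section Dichotomy

variable {F : Type*} [Field F] [ValuativeRel F] [TopologicalSpace F] [IsNonarchimedeanLocalField F]
  {n : ℕ} {V : Type*} [AddCommGroup V] [Module ℂ V] (π : Representation ℂ (GL (Fin n) F) V) (ψ : AddChar F Circle)

/-- **`rank Hom_U(π, ψ_U) ≤ 1` ⇒ for every subrepresentation `N` of a smooth `π`: `Hom_U(N, ψ_U) = 0` or `Hom_U(π ⁄ N, ψ_U) = 0`.**  A non-zero Whittaker functional `μ` of
`π ⁄ N` gives the generator `μ ∘ [·]` of `Hom_U(π, ψ_U)`, which kills `N`; and every Whittaker functional of `N` extends to `π` (dual of the INJECTIVITY of `J_ψ(N) → J_ψ(π)`, ★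
`twistedJacquetMap_injective`), so it is `0`. [cite: BernsteinZelevinskyASENS1977, Prop. 1.9 (a), §4.7] [cite: BushnellHenniart2006, §9.6] -/
theorem whittakerFunctionals_eq_bot_or (hπ : π.IsSmooth) (hψ : Continuous ψ) (h1 : Module.rank ℂ ↥(whittakerFunctionals π ψ) ≤ 1)
    (N : Subrepresentation π) :
    whittakerFunctionals N.toRepresentation ψ = ⊥ ∨ whittakerFunctionals N.quotientRep ψ = ⊥ := by
  classical
  by_cases hW : whittakerFunctionals N.quotientRep ψ = ⊥
  · exact Or.inr hW
  left
  obtain ⟨μ, hμ, hμ0⟩ := (Submodule.ne_bot_iff _).1 hW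
  -- `Λ₀ = μ ∘ [·]` is a non-zero Whittaker functional of `π` killing `N`
  set Λ₀ : Module.Dual ℂ V := μ ∘ₗ N.toSubmodule.mkQ with hΛ₀
  have hΛ₀mem : Λ₀ ∈ whittakerFunctionals π ψ := by
    refine (mem_whittakerFunctionals_iff _).2 fun u v => ?_
    rw [hΛ₀, LinearMap.comp_apply, LinearMap.comp_apply, Submodule.mkQ_apply, Submodule.mkQ_apply, ← Subrepresentation.quotientRep_mk,
      (mem_whittakerFunctionals_iff μ).1 hμ u]
  have hΛ₀N : ∀ v ∈ N.toSubmodule, Λ₀ v = 0 := fun v hv => by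
    rw [hΛ₀, LinearMap.comp_apply, Submodule.mkQ_apply, (Submodule.Quotient.mk_eq_zero _).2 hv, map_zero]
  have hΛ₀0 : Λ₀ ≠ 0 := by
    intro h0
    apply hμ0
    refine LinearMap.ext fun q => ?_
    induction q using Submodule.Quotient.induction_on with
    | H v =>
      have h := LinearMap.congr_fun h0 v
      rw [hΛ₀, LinearMap.comp_apply, Submodule.mkQ_apply] at h
      rw [h, LinearMap.zero_apply, LinearMap.zero_apply]
  -- every Whittaker functional of `π` is a multiple of `Λ₀`, hence kills `N`
  obtain ⟨v₀, -, hle⟩ := (rank_submodule_le_one_iff _).1 h1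
  have hall : ∀ Λ ∈ whittakerFunctionals π ψ, ∀ v ∈ N.toSubmodule, Λ v = 0 := by
    intro Λ hΛ v hv
    obtain ⟨c₁, hc₁⟩ := Submodule.mem_span_singleton.1 (hle hΛ₀mem)
    obtain ⟨c₂, hc₂⟩ := Submodule.mem_span_singleton.1 (hle hΛ)
    have hc₁0 : c₁ ≠ 0 := by
      rintro rfl
      rw [zero_smul] at hc₁
      exact hΛ₀0 hc₁.symm
    have hv₀v : v₀ v = 0 := by
      have h2 : c₁ * v₀ v = 0 := by
        have := congrArg (fun L : Module.Dual ℂ V => L v) hc₁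
        simp only [LinearMap.smul_apply, smul_eq_mul] at this
        rw [this]
        exact hΛ₀N v hv
      exact (mul_eq_zero.1 h2).resolve_left hc₁0
    rw [← hc₂, LinearMap.smul_apply, hv₀v, smul_zero]
  -- a Whittaker functional of `N` extends to `π` (exactness of `J_ψ`), hence vanishes
  refine (Submodule.eq_bot_iff _).2 fun lam hlam => ?_
  have hJ : Function.Injective (twistedJacquetMap ψ (Subrepresentation.subtypeIntertwiningMap N)) :=
    twistedJacquetMap_injective ψ hπ hψ _ (Subrepresentation.subtypeIntertwiningMap_injective N)
  obtain ⟨Λbar, hΛbar⟩ := LinearMap.dualMap_surjective_of_injective hJ (whittakerFunctionalsEquivDual _ ψ ⟨lam, hlam⟩)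
  refine LinearMap.ext fun w => ?_
  have h1 : lam w = Λbar (Representation.Coinvariants.mk _ ((Subrepresentation.subtypeIntertwiningMap N) w)) := by
    have := LinearMap.congr_fun hΛbar (Representation.Coinvariants.mk _ w)
    rw [LinearMap.dualMap_apply, twistedJacquetMap_mk, whittakerFunctionalsEquivDual_apply_mk] at this
    exact this.symm
  have h2 : (((whittakerFunctionalsEquivDual π ψ).symm Λbar : ↥(whittakerFunctionals π ψ)) : Module.Dual ℂ V) ((Subrepresentation.subtypeIntertwiningMap N) w) =
      Λbar (Representation.Coinvariants.mk _ ((Subrepresentation.subtypeIntertwiningMap N) w)) := by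
    rw [whittakerFunctionalsEquivDual_symm_apply]
  rw [LinearMap.zero_apply, h1, ← h2]
  exact hall _ ((whittakerFunctionalsEquivDual π ψ).symm Λbar).2 _ w.2

end Dichotomy

/-! ## §2  `GL₂`: a degenerate representation is `N`-trivial, and then `G` acts through `det` -/

section Degenerate

variable {F : Type*} [Field F] [ValuativeRel F] [TopologicalSpace F] [IsNonarchimedeanLocalField F]
  {V : Type*} [AddCommGroup V] [Module ℂ V] (π : Representation ℂ (GL (Fin 2) F) V)

omit [ValuativeRel F] [TopologicalSpace F] [IsNonarchimedeanLocalField F] in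
/-- `Hom_U(π, ψ_U) = 0 ⇒ Hom_U(π, (ψ_a)_U) = 0` for every `a ∈ F^×` (`Λ ↦ Λ ∘ π(d(a⁻¹,1))`, ★ `comp_diagGL2_mem_whittakerFunctionals`). [cite: JacquetLanglands1970, Prop. 2.8] -/
theorem whittakerFunctionals_mulShift_eq_bot {ψ : AddChar F Circle} (h0 : whittakerFunctionals π ψ = ⊥) (a : Fˣ) :
    whittakerFunctionals π (ψ.mulShift (a : F)) = ⊥ := by
  refine (Submodule.eq_bot_iff _).2 fun Λ hΛ => ?_
  have hmem := comp_diagGL2_mem_whittakerFunctionals π hΛ a⁻¹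
  rw [AddChar.mulShift_mulShift, Units.mul_inv, AddChar.mulShift_one, h0, Submodule.mem_bot] at hmem
  refine LinearMap.ext fun w => ?_
  have h := LinearMap.congr_fun hmem (π (diagGL2 a 1) w)
  rw [LinearMap.comp_apply, ← Module.End.mul_apply, ← map_mul, ← diagGL2_mul, inv_mul_cancel, mul_one, diagGL2_one, map_one,
    Module.End.one_apply, LinearMap.zero_apply] at h
  rw [h, LinearMap.zero_apply]

omit [ValuativeRel F] [TopologicalSpace F] [IsNonarchimedeanLocalField F] in
/-- `Hom_U(π, ψ_U) = 0 ⇒ π(U, ψ) = π` (every vector dies in `J_ψ(π)`, whose dual is `Hom_U(π,ψ_U)`, ★ `whittakerFunctionalsEquivDual`). [cite: Bump1997, Prop. 4.4.4] -/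
theorem mem_ker_whittakerTwist_of_eq_bot {ψ : AddChar F Circle} (h0 : whittakerFunctionals π ψ = ⊥) (v : V) :
    v ∈ Representation.Coinvariants.ker (whittakerTwist π ψ) := by
  rw [← Representation.Coinvariants.mk_eq_zero]
  refine (Module.forall_dual_apply_eq_zero_iff ℂ _).1 fun φ => ?_
  have h : (((whittakerFunctionalsEquivDual π ψ).symm φ : ↥(whittakerFunctionals π ψ)) : Module.Dual ℂ V) = 0 :=
    (Submodule.eq_bot_iff _).1 h0 _ ((whittakerFunctionalsEquivDual π ψ).symm φ).2
  have h' := LinearMap.congr_fun h v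
  rwa [whittakerFunctionalsEquivDual_symm_apply, LinearMap.zero_apply] at h'

/-- **A DEGENERATE smooth representation of `GL₂(F)` is `N`-trivial** (Jacquet–Langlands 1970, Prop. 2.8 (ii) ★ `forall_unipotentGL2_apply_eq_of_forall_mem_ker`, applied
with `π(U, ψ_a) = π` for ALL `a`). [cite: JacquetLanglands1970, Prop. 2.8 (ii)] -/
theorem forall_unipotentGL2_apply_eq_of_whittakerFunctionals_eq_bot (hπ : π.IsSmooth) {ψ : AddChar F Circle} (hψ : ψ.IsContinuousNontrivial)
    (h0 : whittakerFunctionals π ψ = ⊥) (v : V) (y : F) :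
    π ((unipotentGL2 y : ↥(upperUnitriangular (Fin 2) F)) : GL (Fin 2) F) v = v :=
  forall_unipotentGL2_apply_eq_of_forall_mem_ker π hπ hψ
    (fun a => mem_ker_whittakerTwist_of_eq_bot π (whittakerFunctionals_mulShift_eq_bot π h0 a) v) y

/-- **On an `N`-trivial smooth representation `G` acts through `det`: `π(g) v = π(d(det g, 1)) v`** (the stabiliser of `v` is open and contains `N`, hence `SL₂(F)` ★
`mem_of_isOpen_of_unipotentGL2_mem`; and `d(det g,1)⁻¹ g ∈ SL₂(F)`). [cite: JacquetLanglands1970, Prop. 2.7 (b) (proof)] -/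
theorem apply_eq_apply_diagGL2_det (hπ : π.IsSmooth)
    (hN : ∀ (y : F) (v : V), π ((unipotentGL2 y : ↥(upperUnitriangular (Fin 2) F)) : GL (Fin 2) F) v = v) (g : GL (Fin 2) F) (v : V) :
    π g v = π (diagGL2 (Matrix.GeneralLinearGroup.det g) 1) v := by
  have hfix : ∀ g' : GL (Fin 2) F, Matrix.det (g' : Matrix (Fin 2) (Fin 2) F) = 1 → π g' v = v := fun g' hg' =>
    (π.mem_stabilizerSubgroup v g').1
      (mem_of_isOpen_of_unipotentGL2_mem (hπ v) (fun x => (π.mem_stabilizerSubgroup v _).2 (hN x v)) hg')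
  have h := hfix _ (det_diagGL2_det_inv_mul g)
  conv_lhs => rw [← mul_inv_cancel_left (diagGL2 (Matrix.GeneralLinearGroup.det g) (1 : Fˣ)) g, map_mul, Module.End.mul_apply, h]

end Degenerate

/-! ## §3  An admissible `N`-trivial `π ≠ 0` contains a line `ℂ v` on which `G` acts by `η ∘ det`; hence `⟦η ∘ det⟧` is a constituent -/

section Line

variable {F : Type*} [Field F] [ValuativeRel F] [TopologicalSpace F] [IsNonarchimedeanLocalField F]
  {V : Type*} [AddCommGroup V] [Module ℂ V] (π : Representation ℂ (GL (Fin 2) F) V)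

/-- **A `det`-EIGENLINE.**  If `π` is admissible, `≠ 0` and `N`-trivial then some `v ≠ 0` satisfies `π(g) v = η(det g) v` for a character `η : F^× → ℂ^×`: for a compact open
`K` fixing a given `v₀ ≠ 0`, `V^K` is finite-dimensional (admissibility), non-zero and stable under the torus `d(a,1)` (everything acts through `det`, and the torus is
commutative), so the commuting family `π(d(a,1))|_{V^K}` has a common eigenvector (★ `exists_common_eigenvector`). [cite: JacquetLanglands1970, Prop. 2.7 (proof)]
[cite: BushnellHenniart2006, §9.11] -/
theorem exists_line_detChar (hadm : π.IsAdmissible)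
    (hN : ∀ (y : F) (v : V), π ((unipotentGL2 y : ↥(upperUnitriangular (Fin 2) F)) : GL (Fin 2) F) v = v) [Nontrivial V] :
    ∃ (v : V) (η : Fˣ →* ℂˣ), v ≠ 0 ∧ ∀ g : GL (Fin 2) F, π g v = ((η (Matrix.GeneralLinearGroup.det g) : ℂˣ) : ℂ) • v := by
  classical
  have hπ := hadm.isSmooth
  have hdet := apply_eq_apply_diagGL2_det π hπ hN
  obtain ⟨v₀, hv₀⟩ := exists_ne (0 : V)
  -- a compact open subgroup `K` fixing `v₀`
  haveI : LocallyCompactSpace (GL (Fin 2) F) := locallyCompactSpace_gl' F (Fin 2)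
  haveI : NonarchimedeanGroup (GL (Fin 2) F) := nonarchimedeanGroup_gl F 2
  obtain ⟨C, hC, hC1⟩ := exists_compact_mem_nhds (1 : GL (Fin 2) F)
  have h1 : (1 : GL (Fin 2) F) ∈ (π.stabilizerSubgroup v₀ : Set (GL (Fin 2) F)) := Subgroup.one_mem _
  obtain ⟨K, hK⟩ := NonarchimedeanGroup.is_nonarchimedean ((π.stabilizerSubgroup v₀ : Set (GL (Fin 2) F)) ∩ C)
    (Filter.inter_mem ((hπ v₀).mem_nhds h1) hC1)
  have hKc : IsCompact ((K : Subgroup (GL (Fin 2) F)) : Set (GL (Fin 2) F)) :=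
    hC.of_isClosed_subset K.isClosed (hK.trans Set.inter_subset_right)
  haveI hfin : Module.Finite ℂ ↥(π.fixedPoints (K : Subgroup (GL (Fin 2) F))) := hadm.finite_fixedPoints K hKc
  have hv₀K : v₀ ∈ π.fixedPoints (K : Subgroup (GL (Fin 2) F)) :=
    (π.mem_fixedPoints _ _).2 fun g hg => (π.mem_stabilizerSubgroup v₀ g).1 (hK hg).1
  haveI : Nontrivial ↥(π.fixedPoints (K : Subgroup (GL (Fin 2) F))) :=
    ⟨⟨⟨v₀, hv₀K⟩, 0, fun h => hv₀ (congrArg Subtype.val h)⟩⟩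
  -- the torus commutes with everything through `det`
  have hcomm : ∀ a b : Fˣ, diagGL2 a (1 : Fˣ) * diagGL2 b 1 = diagGL2 b 1 * diagGL2 a 1 := fun a b => by
    rw [← diagGL2_mul, ← diagGL2_mul, mul_comm]
  have hstab : ∀ (a : Fˣ), ∀ w ∈ π.fixedPoints (K : Subgroup (GL (Fin 2) F)), π (diagGL2 a 1) w ∈ π.fixedPoints (K : Subgroup (GL (Fin 2) F)) := by
    intro a w hw
    rw [Representation.mem_fixedPoints] at hw ⊢
    intro k hk
    rw [hdet k, ← Module.End.mul_apply, ← map_mul, hcomm, map_mul, Module.End.mul_apply, ← hdet k w, hw k hk]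
  -- the commuting family `T_a = π(d(a,1))|_{V^K}` and its common eigenvector
  let T : Fˣ → Module.End ℂ ↥(π.fixedPoints (K : Subgroup (GL (Fin 2) F))) := fun a => (π (diagGL2 a 1)).restrict (hstab a)
  have hT : ∀ a b, Commute (T a) (T b) := fun a b => by
    refine LinearMap.ext fun w => Subtype.ext ?_
    change π (diagGL2 a 1) (π (diagGL2 b 1) (w : V)) = π (diagGL2 b 1) (π (diagGL2 a 1) (w : V))
    rw [← Module.End.mul_apply, ← map_mul, hcomm, map_mul, Module.End.mul_apply]
  obtain ⟨w, hw0, c, hc⟩ := exists_common_eigenvector T hT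
  have hc' : ∀ a : Fˣ, π (diagGL2 a 1) (w : V) = c a • (w : V) := fun a => by
    have := congrArg Subtype.val (hc a)
    exact this
  have hw0' : (w : V) ≠ 0 := fun h => hw0 (Subtype.ext h)
  -- `c` is a character
  have hc1 : c 1 = 1 := by
    have h := hc' 1
    rw [diagGL2_one, map_one, Module.End.one_apply] at h
    exact (smul_left_injective ℂ hw0' (by simpa using h.symm : c 1 • (w : V) = (1 : ℂ) • (w : V))).symm ▸ rfl
  have hmul : ∀ a b : Fˣ, c (a * b) = c a * c b := fun a b => by
    have h1 : π (diagGL2 (a * b) 1) (w : V) = (c a * c b) • (w : V) := by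
      rw [show diagGL2 (a * b) (1 : Fˣ) = diagGL2 a 1 * diagGL2 b 1 by rw [← diagGL2_mul, mul_one], map_mul, Module.End.mul_apply, hc' b,
        map_smul, hc' a, smul_smul, mul_comm]
    have h2 := hc' (a * b)
    rw [h1] at h2
    exact (smul_left_injective ℂ hw0' h2).symm
  have hc0 : ∀ a : Fˣ, c a ≠ 0 := fun a h0 => by
    have h := hmul a⁻¹ a
    rw [inv_mul_cancel, hc1, h0, mul_zero] at h
    exact one_ne_zero h
  have hη : ∀ a b : Fˣ, Units.mk0 (c (a * b)) (hc0 (a * b)) = Units.mk0 (c a) (hc0 a) * Units.mk0 (c b) (hc0 b) := fun a b =>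
    Units.ext (by rw [Units.val_mk0, Units.val_mul, Units.val_mk0, Units.val_mk0, hmul])
  refine ⟨(w : V), MonoidHom.mk' (fun a => Units.mk0 (c a) (hc0 a)) hη, hw0', fun g => ?_⟩
  rw [hdet g, hc', MonoidHom.mk'_apply, Units.val_mk0]

/-- **`⟦η ∘ det⟧` IS A CONSTITUENT OF A DEGENERATE ADMISSIBLE `π ≠ 0`** (spaces in `Type`): §2 makes `π` `N`-trivial, §3 gives the line `ℂ v` with character `η ∘ det`
(open kernel ⊇ the stabiliser of `v`), and ★ `isConstituentOf_iff_eq_mk_ofChar_of_forall_apply_eq_smul` ∘ ★ `IsConstituentOf.of_subrepresentation`.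
[cite: JacquetLanglands1970, Thm. 3.3] [cite: BushnellHenniart2006, §9.11] -/
theorem exists_isConstituentOf_ofChar_det {F : Type} [Field F] [ValuativeRel F] [TopologicalSpace F] [IsNonarchimedeanLocalField F]
    {V : Type} [AddCommGroup V] [Module ℂ V] (π : Representation ℂ (GL (Fin 2) F) V) (hadm : π.IsAdmissible) [Nontrivial V]
    {ψ : AddChar F Circle} (hψ : ψ.IsContinuousNontrivial) (h0 : whittakerFunctionals π ψ = ⊥) :
    ∃ (η : Fˣ →* ℂˣ) (hη : IsOpen (((η.comp Matrix.GeneralLinearGroup.det).ker : Subgroup (GL (Fin 2) F)) : Set (GL (Fin 2) F))),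
      (IrrClass.mk (SmoothIrrep.ofChar (η.comp Matrix.GeneralLinearGroup.det) hη)).IsConstituentOf π := by
  have hN := forall_unipotentGL2_apply_eq_of_whittakerFunctionals_eq_bot π hadm.isSmooth hψ h0
  obtain ⟨v, η, hv0, hv⟩ := exists_line_detChar π hadm (fun y w => hN w y)
  have hχ : IsOpen (((η.comp Matrix.GeneralLinearGroup.det).ker : Subgroup (GL (Fin 2) F)) : Set (GL (Fin 2) F)) := by
    refine Subgroup.isOpen_mono (H₁ := π.stabilizerSubgroup v) (fun g hg => ?_) (hadm.isSmooth v)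
    rw [Representation.mem_stabilizerSubgroup] at hg
    rw [MonoidHom.mem_ker]
    have h1 : (((η.comp Matrix.GeneralLinearGroup.det) g : ℂˣ) : ℂ) • v = (1 : ℂ) • v := by rw [one_smul, MonoidHom.comp_apply, ← hv g, hg]
    exact Units.val_eq_one.1 (smul_left_injective ℂ hv0 h1)
  -- the line `ℂ v`
  let L : Subrepresentation π :=
    { toSubmodule := ℂ ∙ v
      apply_mem_toSubmodule := fun g w hw => by
        obtain ⟨t, rfl⟩ := Submodule.mem_span_singleton.1 hw
        rw [map_smul, hv g, smul_smul]
        exact Submodule.smul_mem _ _ (Submodule.mem_span_singleton_self v) }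
  haveI : Nontrivial ↥L.toSubmodule := ⟨⟨⟨v, Submodule.mem_span_singleton_self v⟩, 0, fun h => hv0 (congrArg Subtype.val h)⟩⟩
  have hL : ∀ (g : GL (Fin 2) F) (w : ↥L.toSubmodule), L.toRepresentation g w = (((η.comp Matrix.GeneralLinearGroup.det) g : ℂˣ) : ℂ) • w := fun g w => by
    apply Subtype.ext
    obtain ⟨t, ht⟩ := Submodule.mem_span_singleton.1 w.2
    change π g (w : V) = (((η.comp Matrix.GeneralLinearGroup.det) g : ℂˣ) : ℂ) • (w : V)
    rw [← ht, map_smul, hv g, smul_comm, MonoidHom.comp_apply]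
  exact ⟨η, hχ, ((IrrClass.isConstituentOf_iff_eq_mk_ofChar_of_forall_apply_eq_smul L.toRepresentation _ hχ hL _).2 rfl).of_subrepresentation L⟩

end Line

/-! ## §4  The principal series `x × y` of `GL₂(F)` -/

section PrincipalSeries

variable {F : Type} [Field F] [ValuativeRel F] [TopologicalSpace F] [IsNonarchimedeanLocalField F]

/-- The inducing datum `(𝟙.twist χ) ∘ proj ⊗ δ^{1∕2}` is trivial on the unipotent radical (any labels). [folklore] -/
theorem twist_comp_leviProjection_apply_eq_one {n : ℕ} {α : Type*} [LinearOrder α] [Fintype α] (c : Fin n → α)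
    {W : Type*} [AddCommGroup W] [Module ℂ W] (σ : Representation ℂ (Π a, GL {i // c i = a} F) W)
    (p : ↥(standardParabolicGL F c)) (hp : (p : GL (Fin n) F) ∈ unipotentRadicalGL F c) :
    Representation.twist (σ.comp (leviProjection F c)) (rootDeltaChar (standardParabolicGL F c)) p = 1 := by
  have hp' : p ∈ unipotentRadicalP F c := by
    obtain ⟨q, hq, hqp⟩ := hp
    have : q = p := Subtype.ext hqp
    exact this ▸ hq
  apply LinearMap.ext
  intro w
  rw [Representation.twist_apply, rootDeltaChar_eq_one_of_mem_unipotentRadicalP F c hp', Units.val_one, one_smul, MonoidHom.comp_apply]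
  have : leviProjection F c p = 1 := hp'
  rw [this, map_one]

/-- **`rank Hom_U(x × y, ψ_U) ≤ 1`** — Rodier–Bernstein–Zelevinsky heredity (★ `exists_injective_whittakerFunctionals_smoothIndRep`) embeds the Whittaker functionals of
`i_{Q}(χ)` into the Levi Whittaker functionals of the one-dimensional inducing datum, a subspace of `Dual ℂ ℂ`. [cite: BernsteinZelevinskyASENS1977, Thm. 5.2, §4.7] -/
theorem rank_whittakerFunctionals_parabolicIndGL_char_le_one {n : ℕ} {α : Type} [LinearOrder α] [Fintype α] (c : Fin n → α) (hc : Monotone c)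
    (χ : (Π a, GL {i // c i = a} F) →* ℂˣ) (hχ : IsOpen ((χ.ker : Subgroup (Π a, GL {i // c i = a} F)) : Set (Π a, GL {i // c i = a} F)))
    {ψ : AddChar F Circle} (hψ : ψ.IsContinuousNontrivial) :
    Module.rank ℂ ↥(whittakerFunctionals (Representation.parabolicIndGL F c ((Representation.trivial ℂ (Π a, GL {i // c i = a} F) ℂ).twist χ)) ψ) ≤ 1 := by
  have hσ : ((Representation.trivial ℂ (Π a, GL {i // c i = a} F) ℂ).twist χ).IsSmooth := (Liu2021.SplitPlace.isAdmissible_trivial_twist _ hχ).isSmooth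
  obtain ⟨Λ, hΛ⟩ := exists_injective_whittakerFunctionals_smoothIndRep (F := F) (c := c)
    (σ' := Representation.twist (((Representation.trivial ℂ (Π a, GL {i // c i = a} F) ℂ).twist χ).comp (leviProjection F c))
      (rootDeltaChar (standardParabolicGL F c))) ψ hc (hσ.twist_comp_leviProjection F c)
    (fun p hp => twist_comp_leviProjection_apply_eq_one c _ p hp) hψ
  calc Module.rank ℂ ↥(whittakerFunctionals (Representation.parabolicIndGL F c ((Representation.trivial ℂ (Π a, GL {i // c i = a} F) ℂ).twist χ)) ψ)
      ≤ Module.rank ℂ ↥(leviWhittakerFunctionals c (Representation.twist (((Representation.trivial ℂ (Π a, GL {i // c i = a} F) ℂ).twist χ).comp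
          (leviProjection F c)) (rootDeltaChar (standardParabolicGL F c))) ψ) := LinearMap.rank_le_of_injective Λ hΛ
    _ ≤ Module.rank ℂ (Module.Dual ℂ ℂ) := Submodule.rank_le _
    _ ≤ 1 := rank_dual_le_one_iff.2 (Module.rank_self ℂ).le

/-- **BRICK G2 (Jacquet–Langlands 1970, Thm. 3.3, reducible half): a REDUCIBLE `x × y` has a one-dimensional constituent `η ∘ det`.**  For continuous characters
`x, y : F^× → ℂ^×` (so `x × y = i_{Q_{(1,1)}}(x ⊠ y)` is admissible and non-zero) and a continuous non-trivial `ψ`: if `x × y` is NOT irreducible then for some character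
`η : F^× → ℂ^×` (with `η ∘ det` of open kernel) the class `⟦η ∘ det⟧` is a constituent (★ `IrrClass.IsConstituentOf`) of `x × y`.  Proof: a proper non-zero
subrepresentation `V`; by §4 `rank Hom_U(x × y, ψ_U) ≤ 1`, so (§1) `V` or `(x × y)⁄V` is degenerate, admissible and non-zero, hence (§3) has the constituent `⟦η∘det⟧`.
[cite: JacquetLanglands1970, Thm. 3.3 p. 101] [cite: BushnellHenniart2006, §9.6, §9.11] -/
theorem exists_isConstituentOf_ofChar_det_of_not_isIrreducible {ψ : AddChar F Circle} (hψ : ψ.IsContinuousNontrivial)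
    (x y : Fˣ →* ℂˣ) (hx : Continuous fun a => ((x a : ℂˣ) : ℂ)) (hy : Continuous fun a => ((y a : ℂˣ) : ℂ))
    (h : ¬ (Representation.parabolicIndGL F (lastBlockLabel 2)
      ((Representation.trivial ℂ (Π a : Bool, GL {i : Fin 2 // lastBlockLabel 2 i = a} F) ℂ).twist (maxParabolicLeviChar F 2 x y))).IsIrreducible) :
    ∃ (η : Fˣ →* ℂˣ) (hη : IsOpen (((η.comp Matrix.GeneralLinearGroup.det).ker : Subgroup (GL (Fin 2) F)) : Set (GL (Fin 2) F))),
      (IrrClass.mk (SmoothIrrep.ofChar (η.comp Matrix.GeneralLinearGroup.det) hη)).IsConstituentOf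
        (Representation.parabolicIndGL F (lastBlockLabel 2)
          ((Representation.trivial ℂ (Π a : Bool, GL {i : Fin 2 // lastBlockLabel 2 i = a} F) ℂ).twist (maxParabolicLeviChar F 2 x y))) := by
  have hadm := F0P3bSplitMemberAdmissible.parabolicIndGL_leviChar_isAdmissible F 2 x y hx hy
  haveI := nontrivial_parabolicIndGL_detChar F 2 x y hx hy
  have hχ := Liu2021.SplitPlace.isOpen_ker_maxParabolicLeviChar 2 x y (Liu2021.SplitPlace.isOpen_ker_of_continuous x hx)
    (Liu2021.SplitPlace.isOpen_ker_of_continuous y hy)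
  have h1 := rank_whittakerFunctionals_parabolicIndGL_char_le_one (F := F) (lastBlockLabel 2) (monotone_lastBlockLabel 2) (maxParabolicLeviChar F 2 x y) hχ hψ
  -- a proper non-zero subrepresentation
  obtain ⟨N, hNb, hNt⟩ : ∃ N : Subrepresentation (Representation.parabolicIndGL F (lastBlockLabel 2)
      ((Representation.trivial ℂ (Π a : Bool, GL {i : Fin 2 // lastBlockLabel 2 i = a} F) ℂ).twist (maxParabolicLeviChar F 2 x y))), N ≠ ⊥ ∧ N ≠ ⊤ := by
    by_contra hall
    push Not at hall
    apply h
    haveI : Nontrivial (Subrepresentation (Representation.parabolicIndGL F (lastBlockLabel 2)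
        ((Representation.trivial ℂ (Π a : Bool, GL {i : Fin 2 // lastBlockLabel 2 i = a} F) ℂ).twist (maxParabolicLeviChar F 2 x y)))) :=
      ⟨⟨⊥, ⊤, fun hbt => bot_ne_top (congrArg Subrepresentation.toSubmodule hbt)⟩⟩
    exact { eq_bot_or_eq_top := fun N => (em (N = ⊥)).imp id (hall N) }
  rcases whittakerFunctionals_eq_bot_or _ ψ hadm.isSmooth hψ.1 h1 N with h0 | h0
  · haveI : Nontrivial ↥N.toSubmodule :=
      Submodule.nontrivial_iff_ne_bot.2 fun hb => hNb (Subrepresentation.toSubmodule_injective hb)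
    obtain ⟨η, hη, hc⟩ := exists_isConstituentOf_ofChar_det N.toRepresentation (hadm.toRepresentation N) hψ h0
    exact ⟨η, hη, hc.of_subrepresentation N⟩
  · haveI : Nontrivial (_ ⧸ N.toSubmodule) :=
      Submodule.Quotient.nontrivial_iff.2 fun ht => hNt (Subrepresentation.toSubmodule_injective ht)
    obtain ⟨η, hη, hc⟩ := exists_isConstituentOf_ofChar_det N.quotientRep (hadm.quotientRep N) hψ h0
    exact ⟨η, hη, hc.of_quotientRep N⟩

end PrincipalSeries

end Summit.HodgeConjecture.HodgeConjecture.Cruxes.H413.K2E3GL2ReducibleInducedDetCharConstituent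

end
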